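import Summits.Ventures.Crystal3D.Theorems.StickyWulffConstantCoaxialWallLawEndRowDefsA
import HarnessLib

/-!
# Definitions: the ROOT-CLASS word-end multiplicity row — the weakest sufficient JOINT row for two unrelated grains
# (lane T, crux `TextureLiminfV5`, stmt-Ventures-23912, registered stub `stub_terraceCensus`; cf-p1 RULINGS (ccc)(2)(i) / (ccci), 2026-08-29)

HONEST FRAMING. Venture `Summits/Ventures/Crystal3D` (cell `crystal3d-full`), route `route-Ventures-StickyWulffConstant`.
DEFINITIONS ONLY (plus the monotonicity one-liners that say which way they compare); nothing is claimed here; no census fact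
is proved; no certificate is named; F-C1 not moved.

WHY.  The (β) plates side of lane T pools the cut hexagon censuses of BOTH clamped plates under ONE application of a local
row (`hexagon_twoPlate_sources_le_payers_cuts`, …LevelReachHexagonPooled, p747300), taking lane F's abstract row
`LocalEndRowA ver sF S₁ S₂` (…EndRowDefsA) for the PAIR of plate systems `S₁ = ⟨Fr, inPlaneRoots Fr 1⟩` (bottom plate,
rising hexagon roots), `S₂ = ⟨G₂, inPlaneRoots G₂ (−1)⟩` (top plate, falling hexagon roots).  That row bounds, at every
payer, the load of ALL (A)-end pairs of the FULL word nets of the two systems (every well-formed chain class of every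
root), whereas the cut hexagon censuses only ever produce STRAIGHT ROOT-CLASS endings (…LevelReachHexagonBarlowShape:
`bq.2 = bq.1 − Fr r'`, the end ball not moving in the class `(Fr, Fr r')`; and — …LevelReachHexagonBarlowRoot — the mover
READ in the root class with its own root-class predecessor present).  19480-p1 g23's TRIPWIRE (HOME/wall-p1-g23/
BETA-PLATES-g23.md §5, cf-p1 (ccc)): for two UNRELATED grains the pair `(S₁, S₂)` is not the twin / half-turn pair of one
frame that lane F's certificates speak about, so the joint row is a census object of its own, and it should be asked for in
its WEAKEST SUFFICIENT form.  This file types that form: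

* `IsRootEndPair X v S b q` — `(b, q)` is a ROOT-CLASS end pair of the ONE system `S`: for a root `r ∈ S.RT`, `q = b − S.G₀ r`
  is the root-class predecessor of `b`, `q` carries its own predecessor `q − S.G₀ r ∈ X` (clause (A)), `q` END-MOVES onto
  `b = q + S.G₀ r` in the root class `(S.G₀, S.G₀ r)` (`IsEndMove`: a FULL / NARROW-under-`v2` / twin-GLIDE reading at `q`,
  and `b` is not moving in that class), and `b` has two payers;
* `IsEndPairRootA X v S₁ S₂ b q` — root-class end pair of `S₁` OR of `S₂`; `endMultRootA` — its multiplicity at `b`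
  (at most `#S₁.RT + #S₂.RT`, i.e. `≤ 3 + 3` for hexagon systems: `endMultRootA_le_card_roots`);
* `LocalEndRowRootA v sF S₁ S₂` — VERBATIM the shape of `LocalEndRowA` (pooling radius `1`, weight `endMultRootA / pooledDef`);
* `EndRowBiFrameRootA v sF` — the census fact BY NAME for the (β) two-plate pooling: the root row for EVERY frame pair
  `(⟨G₁, inPlaneRoots G₁ 1⟩, ⟨G₂, inPlaneRoots G₂ (−1)⟩)` (rising hexagon roots of the bottom grain, falling of the top grain);
* comparison: `isEndPairA_of_isEndPairRootA`, `endMultRootA_le_endMultA`, **`localEndRowRootA_of_localEndRowA`** — the root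
  row only REMOVES pairs from the (A) row, so it is the WEAKER hypothesis (any certificate for `LocalEndRowA` of the pair
  covers it; a certificate may instead be stated for root-class moves only).
The discharge `card_endPairs_le_of_localRootRow` and the pooled two-plate bound under this row are the next files.
WHAT THIS IS NOT: not a census fact, not a certificate, not the discharge; F-C1 not moved.
-/

noncomputable section

namespace Summit.Ventures.Crystal3D.Theorems

open Summit.Ventures.Crystal3D Finset
open scoped InnerProductSpace

section Row

variable (X : Finset (EuclideanSpace ℝ (Fin 3)))

/-- **ROOT-CLASS END PAIR of one plate system.**  `(b, q)` is a root-class end pair of `S` under version `v`: `q, b ∈ X`,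
`b` has two payers, and for some root `r ∈ S.RT` the mover `q` is the root-class predecessor of `b` (`b = q + S.G₀ r`),
carries its own predecessor (`q − S.G₀ r ∈ X`, clause (A)), and END-MOVES onto `b` in the ROOT class `(S.G₀, S.G₀ r)`
(`IsEndMove`: a straight reading at `q` — FULL, NARROW under `v2`, or a twin GLIDE — and `b` not moving in that class). -/
def IsRootEndPair (v : WordVersion) (S : PlateSystem) (b q : EuclideanSpace ℝ (Fin 3)) : Prop :=
  q ∈ X ∧ b ∈ X ∧ HasTwoPayers X b ∧
    ∃ r ∈ S.RT, b = q + S.G₀ r ∧ q - S.G₀ r ∈ X ∧ IsEndMove X v S.G₀ (S.G₀ r) q b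

/-- **ROOT-CLASS END PAIR of the two-plate pair `(S₁, S₂)`**: a root-class end pair of `S₁` or of `S₂`. -/
def IsEndPairRootA (v : WordVersion) (S₁ S₂ : PlateSystem) (b q : EuclideanSpace ℝ (Fin 3)) : Prop :=
  IsRootEndPair X v S₁ b q ∨ IsRootEndPair X v S₂ b q

open scoped Classical in
/-- **ROOT-CLASS END MULTIPLICITY** of the ball `b`: the number of balls `q` with `(b, q)` a root-class end pair of
`(S₁, S₂)`. -/
def endMultRootA (v : WordVersion) (S₁ S₂ : PlateSystem) (b : EuclideanSpace ℝ (Fin 3)) : ℕ :=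
  (X.filter fun q => IsEndPairRootA X v S₁ S₂ b q).card

end Row

open scoped Classical in
/-- **THE ROOT-CLASS LOCAL ROW** for the plate systems `(S₁, S₂)` with constant `sF` (pooling radius `1`) — verbatim the
shape of `LocalEndRowA` with the root-class multiplicity: for every finite `1`-separated configuration and every payer `z`
(`deg z ≤ 11`), the root-class end balls within distance `1` of `z` load it by at most `sF` per unit of their pooled
deficiency. -/
def LocalEndRowRootA (v : WordVersion) (sF : ℝ) (S₁ S₂ : PlateSystem) : Prop :=
  ∀ (X : Finset (EuclideanSpace ℝ (Fin 3))), (∀ p ∈ X, ∀ q ∈ X, p ≠ q → 1 ≤ dist p q) →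
  ∀ z ∈ X, (X.filter fun q => dist z q = 1).card ≤ 11 →
    ∑ b ∈ X.filter (fun b => dist z b ≤ 1 ∧ 0 < endMultRootA X v S₁ S₂ b),
      (endMultRootA X v S₁ S₂ b : ℝ) / pooledDef X b ≤ sF

/-- **CENSUS FACT BY NAME (bi-frame root-class row)** — the input of the (β) two-plate pooling: for EVERY pair of frames
`(G₁, G₂)`, the root-class local row with constant `sF` for the bottom system `⟨G₁, inPlaneRoots G₁ 1⟩` (rising in-plane
roots) and the top system `⟨G₂, inPlaneRoots G₂ (−1)⟩` (falling in-plane roots).  A HYPOTHESIS; nothing here proves it. -/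
def EndRowBiFrameRootA (v : WordVersion) (sF : ℝ) : Prop :=
  ∀ G₁ G₂ : EuclideanSpace ℝ (Fin 3) ≃ₗᵢ[ℝ] EuclideanSpace ℝ (Fin 3),
    LocalEndRowRootA v sF ⟨G₁, inPlaneRoots G₁ 1⟩ ⟨G₂, inPlaneRoots G₂ (-1)⟩

/-! ### The root class is admissible; the root row only removes pairs -/

/-- The root class `(S.G₀, S.G₀ r)` of a root `r ∈ S.RT` is an admissible class datum of `S` (the empty chain); a local
copy of `PlateSystem.adm_root` (…TwoLatticeEndMult) to keep this definitions file light. -/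
private theorem adm_root' (S : PlateSystem) {r : EuclideanSpace ℝ (Fin 3)} (hr : r ∈ S.RT) : S.Adm S.G₀ (S.G₀ r) :=
  ⟨r, hr, [], trivial, rfl, by simp [PlateSystem.Fw]⟩

/-- A root-class end pair of `S₁` is an (A)-end pair of `(S₁, S₂)`. -/
theorem isEndPairA_of_isRootEndPair_left {X : Finset (EuclideanSpace ℝ (Fin 3))} {v : WordVersion} {S₁ : PlateSystem}
    (S₂ : PlateSystem) {b q : EuclideanSpace ℝ (Fin 3)} (h : IsRootEndPair X v S₁ b q) : IsEndPairA X v S₁ S₂ b q := by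
  obtain ⟨hq, hb, hpay, r, hr, -, hpred, hmove⟩ := h
  exact ⟨hq, hb, hpay, S₁.G₀, S₁.G₀ r, Or.inl (adm_root' S₁ hr), hpred, hmove⟩

/-- A root-class end pair of `S₂` is an (A)-end pair of `(S₁, S₂)`. -/
theorem isEndPairA_of_isRootEndPair_right {X : Finset (EuclideanSpace ℝ (Fin 3))} {v : WordVersion} (S₁ : PlateSystem)
    {S₂ : PlateSystem} {b q : EuclideanSpace ℝ (Fin 3)} (h : IsRootEndPair X v S₂ b q) : IsEndPairA X v S₁ S₂ b q := by
  obtain ⟨hq, hb, hpay, r, hr, -, hpred, hmove⟩ := h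
  exact ⟨hq, hb, hpay, S₂.G₀, S₂.G₀ r, Or.inr (adm_root' S₂ hr), hpred, hmove⟩

/-- **A root-class end pair is an (A)-end pair.** -/
theorem isEndPairA_of_isEndPairRootA {X : Finset (EuclideanSpace ℝ (Fin 3))} {v : WordVersion} {S₁ S₂ : PlateSystem}
    {b q : EuclideanSpace ℝ (Fin 3)} (h : IsEndPairRootA X v S₁ S₂ b q) : IsEndPairA X v S₁ S₂ b q := by
  rcases h with h | h
  · exact isEndPairA_of_isRootEndPair_left S₂ h
  · exact isEndPairA_of_isRootEndPair_right S₁ h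

open scoped Classical in
/-- `endMultRootA ≤ endMultA`. -/
theorem endMultRootA_le_endMultA (X : Finset (EuclideanSpace ℝ (Fin 3))) (v : WordVersion) (S₁ S₂ : PlateSystem)
    (b : EuclideanSpace ℝ (Fin 3)) : endMultRootA X v S₁ S₂ b ≤ endMultA X v S₁ S₂ b := by
  unfold endMultRootA endMultA
  exact card_le_card (fun q hq => mem_filter.2 ⟨(mem_filter.1 hq).1, isEndPairA_of_isEndPairRootA (mem_filter.1 hq).2⟩)

open scoped Classical in
/-- **At most `#S₁.RT + #S₂.RT` root-class movers per end ball** (`≤ 3 + 3` for hexagon systems): the mover of a root-class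
end pair is `b − S.G₀ r` for its root `r`. -/
theorem endMultRootA_le_card_roots (X : Finset (EuclideanSpace ℝ (Fin 3))) (v : WordVersion) (S₁ S₂ : PlateSystem)
    (b : EuclideanSpace ℝ (Fin 3)) : endMultRootA X v S₁ S₂ b ≤ S₁.RT.card + S₂.RT.card := by
  unfold endMultRootA
  have hcov : (X.filter fun q => IsEndPairRootA X v S₁ S₂ b q) ⊆
      S₁.RT.image (fun r => b - S₁.G₀ r) ∪ S₂.RT.image (fun r => b - S₂.G₀ r) := by
    intro q hq
    rw [mem_union, mem_image, mem_image]
    rcases (mem_filter.1 hq).2 with ⟨-, -, -, r, hr, hbq, -, -⟩ | ⟨-, -, -, r, hr, hbq, -, -⟩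
    · exact Or.inl ⟨r, hr, by rw [hbq, add_sub_cancel_right]⟩
    · exact Or.inr ⟨r, hr, by rw [hbq, add_sub_cancel_right]⟩
  exact (card_le_card hcov).trans ((card_union_le _ _).trans (Nat.add_le_add card_image_le card_image_le))

open scoped Classical in
/-- **The (A) row implies the root row** (same constant): the root row only removes pairs, so it is the WEAKER
hypothesis. -/
theorem localEndRowRootA_of_localEndRowA {v : WordVersion} {sF : ℝ} {S₁ S₂ : PlateSystem}
    (h : LocalEndRowA v sF S₁ S₂) : LocalEndRowRootA v sF S₁ S₂ := by
  intro X hX z hz hz11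
  refine le_trans ?_ (h X hX z hz hz11)
  have hD : ∀ b, 0 ≤ pooledDef X b := by
    intro b
    refine sum_nonneg fun z' hz' => ?_
    have : ((X.filter fun q => dist z' q = 1).card : ℝ) ≤ 11 := by exact_mod_cast (mem_filter.1 hz').2.2
    linarith
  calc ∑ b ∈ X.filter (fun b => dist z b ≤ 1 ∧ 0 < endMultRootA X v S₁ S₂ b),
        (endMultRootA X v S₁ S₂ b : ℝ) / pooledDef X b
      ≤ ∑ b ∈ X.filter (fun b => dist z b ≤ 1 ∧ 0 < endMultRootA X v S₁ S₂ b),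
          (endMultA X v S₁ S₂ b : ℝ) / pooledDef X b :=
        sum_le_sum fun b _ => div_le_div_of_nonneg_right (by exact_mod_cast endMultRootA_le_endMultA X v S₁ S₂ b) (hD b)
    _ ≤ ∑ b ∈ X.filter (fun b => dist z b ≤ 1 ∧ 0 < endMultA X v S₁ S₂ b), (endMultA X v S₁ S₂ b : ℝ) / pooledDef X b := by
        refine sum_le_sum_of_subset_of_nonneg (fun b hb => ?_) fun b _ _ => div_nonneg (Nat.cast_nonneg _) (hD b)
        obtain ⟨hbX, hd, hpos⟩ := mem_filter.1 hb
        exact mem_filter.2 ⟨hbX, hd, lt_of_lt_of_le hpos (endMultRootA_le_endMultA X v S₁ S₂ b)⟩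

/-- For every frame pair, lane F's (A) row of the pair implies the bi-frame root row (pointwise in the frames). -/
theorem endRowBiFrameRootA_of_localEndRowA {v : WordVersion} {sF : ℝ}
    (h : ∀ G₁ G₂ : EuclideanSpace ℝ (Fin 3) ≃ₗᵢ[ℝ] EuclideanSpace ℝ (Fin 3),
      LocalEndRowA v sF ⟨G₁, inPlaneRoots G₁ 1⟩ ⟨G₂, inPlaneRoots G₂ (-1)⟩) : EndRowBiFrameRootA v sF :=
  fun G₁ G₂ => localEndRowRootA_of_localEndRowA (h G₁ G₂)

/-! ### Elementary shape facts of a root-class end pair -/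

/-- The mover of a root-class end pair is at distance `1` from the end ball (slot roots). -/
theorem dist_eq_one_of_isRootEndPair {X : Finset (EuclideanSpace ℝ (Fin 3))} {v : WordVersion} {S : PlateSystem}
    (hS : S.RT ⊆ fccSlots) {b q : EuclideanSpace ℝ (Fin 3)} (h : IsRootEndPair X v S b q) : dist b q = 1 := by
  obtain ⟨-, -, -, r, hr, hbq, -, -⟩ := h
  rw [hbq, dist_eq_norm, add_sub_cancel_left, LinearIsometryEquiv.norm_map, norm_eq_one_of_mem_fccSlots (hS hr)]

/-- The arriving direction of a root-class end pair is the image of its root: `b − q = S.G₀ r`. -/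
theorem exists_root_of_isRootEndPair {X : Finset (EuclideanSpace ℝ (Fin 3))} {v : WordVersion} {S : PlateSystem}
    {b q : EuclideanSpace ℝ (Fin 3)} (h : IsRootEndPair X v S b q) : ∃ r ∈ S.RT, b - q = S.G₀ r := by
  obtain ⟨-, -, -, r, hr, hbq, -, -⟩ := h
  exact ⟨r, hr, by rw [hbq, add_sub_cancel_left]⟩

end Summit.Ventures.Crystal3D.Theorems

end
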